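import Summits.Ventures.HodgeRepro2.T5RecordSatakeRecurrence
import Summits.Ventures.HodgeRepro2.T5RecordSatakeInert
import Summits.Ventures.HodgeRepro2.T5CMFieldSquareDatum

/-!
# The tree recursion at every place that stays prime, with and without the datum

Tier-5 support N3 / §G-N4.2 (seat p3, gen 77). File 247 gives the tree recursion of the explicit cell operators of
the record's spherical Hecke algebra under seat p8's standing local hypotheses; file 233's method discharges them
from `v 𝓞_K = w`, and file 235 supplies the datum:

* **`exists_cells_three_term_record_of_staysPrime`** — at every place `v` of `K⁺` with `v 𝓞_K = w`, good for `H`,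
  `k` of characteristic `0`: `u₀`, `P` with `Pᴴ H_w P = J₃(u₀)`, a uniformiser `ϖ'` of `𝒪_{E_v}`, cells
  `gₙ ↦ P · diag(ϖ'ⁿ, 1, ϖ'⁻ⁿ) · P⁻¹`, and `T₁ T_{n+2} = T_{n+3} + (N(v) − 1) T_{n+2} + N(v)⁴ T_{n+1}`,
  `T₁² = T₂ + (N(v) − 1) T₁ + (N(v)⁴ + N(v)) T₀` for `Tₙ = 1_{K_v gₙ K_v}`;
* **`exists_cells_three_term_record_of_staysPrime'`** — datum-free: some cells `gₙ` with finite double cosets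
  satisfy the two relations.

§8(d): uses an L-value-free non-vanishing device: NO.
-/

open Matrix NumberField NumberField.IsCMField IsDedekindDomain IsDedekindDomain.HeightOneSpectrum Module Polynomial
  MulAction
open scoped TensorProduct Pointwise
open Summit.Ventures.HodgeRepro2.T5UnitaryGroupForm Summit.Ventures.HodgeRepro2.T5UnitaryHeckeAdjoint
  Summit.Ventures.HodgeRepro2.T5HeckePermutationModule Summit.Ventures.HodgeRepro2.T5StarOfInvolution
  Summit.Ventures.HodgeRepro2.T5FinitePlaceCM Summit.Ventures.HodgeRepro2.T5FinitePlaceNormIndex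
  Summit.Ventures.HodgeRepro2.T5NonSplitPlaceUnitaryGroup Summit.Ventures.HodgeRepro2.T5RecordHyperspecial
  Summit.Ventures.HodgeRepro2.T5GlobalLatticeAlmostAll Summit.Ventures.HodgeRepro2.T5HermitianLocalIsotropyN3
  Summit.Ventures.HodgeRepro2.T5FinitePlaceSplitClassification Summit.Ventures.HodgeRepro2.T5HermitianThreeElements
  Summit.Ventures.HodgeRepro2.T5InertPlaceCompletion Summit.Ventures.HodgeRepro2.T5InertPlaceCompletionCells
  Summit.Ventures.HodgeRepro2.T5HeckeDoubleCoset Summit.Ventures.HodgeRepro2.T5CartanCellsDistinct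
  Summit.Ventures.HodgeRepro2.T5RecordSatake Summit.Ventures.HodgeRepro2.T5RecordSatakeInert
  Summit.Ventures.HodgeRepro2.T5RecordSatakeCell Summit.Ventures.HodgeRepro2.T5CMFieldSquareDatum
  Summit.Ventures.HodgeRepro2.T5RecordSatakeRecurrence Summit.Ventures.HodgeRepro2.T5InertGlobalPrime
  Summit.Ventures.HodgeRepro2.T5SplitPlaceUnitaryGroup Summit.Ventures.HodgeRepro2.T5GaloisCartanThree
  Summit.Ventures.HodgeRepro2.T5InertDegreeGalois Summit.Ventures.HodgeRepro2.T5InertDegreeCompletion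
  Summit.Ventures.HodgeRepro2.T5InertDegreeAdicCompletion Summit.Ventures.HodgeRepro2.T5InertSatakeTransform
  Summit.Ventures.HodgeRepro2.T5InertTopCoefficient Summit.Ventures.HodgeRepro2.T5SplitUnitaryGroupEquiv

namespace Summit.Ventures.HodgeRepro2.T5RecordSatakeRecurrenceIntrinsic

section Record

variable (K : Type*) [Field K] [NumberField K] [IsCMField K]
variable (v : HeightOneSpectrum (𝓞 (maximalRealSubfield K))) (w : HeightOneSpectrum (𝓞 K))
  [w.asIdeal.LiesOver v.asIdeal]
variable {θ : maximalRealSubfield K} {y : K}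
  (hθ : algebraMap (maximalRealSubfield K) K θ = y ^ 2) (hy : complexConj K y ≠ y)
  (hmap : Ideal.map (algebraMap (𝓞 (maximalRealSubfield K)) (𝓞 K)) v.asIdeal = w.asIdeal)
variable {r : ℕ} (l : Fin r → 𝓞 K)

include hθ hy hmap in
/-- **THE TREE RECURSION AT EVERY PLACE THAT STAYS PRIME**: file 247 with its local hypotheses discharged by file
233's method (`e(w/v) = 1` from seat p8's `ramificationIdx'_eq_one_of_staysPrime`); the cells are those of a
uniformiser `ϖ'` of `𝒪_{E_v}`. -/
theorem exists_cells_three_term_record_of_staysPrime (k : Type*) [Field k] [CharZero k]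
    (hl : Submodule.span (𝓞 (maximalRealSubfield K)) (Set.range l) = ⊤)
    {H : Matrix (Fin 3) (Fin 3) K} (hH : H.IsHermitian) (hdet : IsUnit H.det) (hgood : w ∉ badSet H) :
    letI := tensorStarRing K v
    letI := starRingOfQuadratic (finrank_eq_two K v w hθ hy (not_isSquare_of_staysPrime K v w hθ hy hmap))
      (localConj v w hθ.symm (span_pair_eq_top K hy) (not_isSquare_of_staysPrime K v w hθ hy hmap) (complexConj K))
      (localConj_ne_one v w hθ.symm (span_pair_eq_top K hy) (not_isSquare_of_staysPrime K v w hθ hy hmap)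
        (complexConj K) (complexConj_apply_eq_neg K hθ hy))
    haveI : IsFractionRing (integralClosure (v.adicCompletionIntegers (maximalRealSubfield K)) (w.adicCompletion K))
      (w.adicCompletion K) :=
      integralClosure.isFractionRing_of_finite_extension (v.adicCompletion (maximalRealSubfield K))
        (w.adicCompletion K)
    ∃ (u₀ : (v.adicCompletionIntegers (maximalRealSubfield K))ˣ) (P : GL (Fin 3) (w.adicCompletion K))
      (g : ℕ → ↥(formUnitaryGroup (tensorGram K v H))),
      P ∈ (Matrix.GeneralLinearGroup.map (algebraMap
        (integralClosure (v.adicCompletionIntegers (maximalRealSubfield K)) (w.adicCompletion K))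
        (w.adicCompletion K))).range ∧
      (P : Matrix (Fin 3) (Fin 3) (w.adicCompletion K))ᴴ * H.map (algebraMap K (w.adicCompletion K)) * P =
        J3 (algebraMap (v.adicCompletionIntegers (maximalRealSubfield K)) (w.adicCompletion K)
          (u₀ : v.adicCompletionIntegers (maximalRealSubfield K))) ∧
      (∃ (ϖ' : integralClosure (v.adicCompletionIntegers (maximalRealSubfield K)) (w.adicCompletion K))
        (hϖ' : Irreducible ϖ'), ∀ n,
        ((recordNonSplitEquiv' K v w hθ hy (not_isSquare_of_staysPrime K v w hθ hy hmap) H (g n) :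
          ↥(formUnitaryGroup (H.map (algebraMap K (w.adicCompletion K))))) : GL (Fin 3) (w.adicCompletion K)) =
          P * cell hϖ' n * P⁻¹) ∧
      ∃ hfin : ∀ n, Finite (orbit (recordHyperspecial K v l H) (g n : _ ⧸ recordHyperspecial K v l H)),
        (∀ n, letI := hfin 1; letI := hfin (n + 1 + 1); letI := hfin (n + 1 + 1 + 1); letI := hfin (n + 1);
          doubleCosetOp k (recordHyperspecial K v l H) (g 1) *
              doubleCosetOp k (recordHyperspecial K v l H) (g (n + 1 + 1)) =
            doubleCosetOp k (recordHyperspecial K v l H) (g (n + 1 + 1 + 1)) +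
              ((Ideal.absNorm v.asIdeal : k) - 1) • doubleCosetOp k (recordHyperspecial K v l H) (g (n + 1 + 1)) +
              (Ideal.absNorm v.asIdeal : k) ^ 4 • doubleCosetOp k (recordHyperspecial K v l H) (g (n + 1))) ∧
        (letI := hfin 1; letI := hfin (0 + 1); letI := hfin (0 + 1 + 1); letI := hfin 0;
          doubleCosetOp k (recordHyperspecial K v l H) (g 1) *
              doubleCosetOp k (recordHyperspecial K v l H) (g (0 + 1)) =
            doubleCosetOp k (recordHyperspecial K v l H) (g (0 + 1 + 1)) +
              ((Ideal.absNorm v.asIdeal : k) - 1) • doubleCosetOp k (recordHyperspecial K v l H) (g (0 + 1)) +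
              ((Ideal.absNorm v.asIdeal : k) ^ 4 + Ideal.absNorm v.asIdeal) •
                doubleCosetOp k (recordHyperspecial K v l H) (g 0)) :=
  haveI := isDiscreteValuationRing_integralClosure_adicCompletion v w
  haveI := finite_residueField_integralClosure_adicCompletion v w
  haveI : IsFractionRing (integralClosure (v.adicCompletionIntegers (maximalRealSubfield K)) (w.adicCompletion K))
      (w.adicCompletion K) :=
    integralClosure.isFractionRing_of_finite_extension (v.adicCompletion (maximalRealSubfield K)) (w.adicCompletion K)
  (exists_irreducible_and_irreducible_algebraMap_of_staysPrime K v w hmap).elim fun _ h =>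
    (exists_cells_three_term_record K v w hθ hy (not_isSquare_of_staysPrime K v w hθ hy hmap) h.1 h.2 l k hl
      (ramificationIdx'_eq_one_of_staysPrime v w hmap) hH hdet hgood).elim fun u₀ h1 => h1.elim fun P h2 =>
      h2.elim fun g h3 => ⟨u₀, P, g, h3.1, h3.2.1, ⟨_, irreducible_uniformiser
        (map_maximalIdeal_integralClosure_eq_of_irreducible v w h.1 h.2) h.1, h3.2.2.1⟩, h3.2.2.2⟩

omit hθ hy in
include hmap in
/-- **THE TREE RECURSION AT EVERY PLACE THAT STAYS PRIME, WITH NO AUXILIARY DATUM**: some cells `gₙ ∈ U(1 ⊗ H)` with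
finite double cosets have characteristic functions `Tₙ` satisfying `T₁ T_{n+2} = T_{n+3} + (N(v) − 1) T_{n+2} +
N(v)⁴ T_{n+1}` and `T₁² = T₂ + (N(v) − 1) T₁ + (N(v)⁴ + N(v)) T₀` (the datum of file 235 chosen inside the proof). -/
theorem exists_cells_three_term_record_of_staysPrime' (k : Type*) [Field k] [CharZero k]
    (hl : Submodule.span (𝓞 (maximalRealSubfield K)) (Set.range l) = ⊤)
    {H : Matrix (Fin 3) (Fin 3) K} (hH : H.IsHermitian) (hdet : IsUnit H.det) (hgood : w ∉ badSet H) :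
    ∃ g : ℕ → (letI := tensorStarRing K v; ↥(formUnitaryGroup (tensorGram K v H))),
      ∃ hfin : ∀ n, Finite (orbit (recordHyperspecial K v l H) (g n : _ ⧸ recordHyperspecial K v l H)),
        (∀ n, letI := hfin 1; letI := hfin (n + 1 + 1); letI := hfin (n + 1 + 1 + 1); letI := hfin (n + 1);
          doubleCosetOp k (recordHyperspecial K v l H) (g 1) *
              doubleCosetOp k (recordHyperspecial K v l H) (g (n + 1 + 1)) =
            doubleCosetOp k (recordHyperspecial K v l H) (g (n + 1 + 1 + 1)) +
              ((Ideal.absNorm v.asIdeal : k) - 1) • doubleCosetOp k (recordHyperspecial K v l H) (g (n + 1 + 1)) +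
              (Ideal.absNorm v.asIdeal : k) ^ 4 • doubleCosetOp k (recordHyperspecial K v l H) (g (n + 1))) ∧
        (letI := hfin 1; letI := hfin (0 + 1); letI := hfin (0 + 1 + 1); letI := hfin 0;
          doubleCosetOp k (recordHyperspecial K v l H) (g 1) *
              doubleCosetOp k (recordHyperspecial K v l H) (g (0 + 1)) =
            doubleCosetOp k (recordHyperspecial K v l H) (g (0 + 1 + 1)) +
              ((Ideal.absNorm v.asIdeal : k) - 1) • doubleCosetOp k (recordHyperspecial K v l H) (g (0 + 1)) +
              ((Ideal.absNorm v.asIdeal : k) ^ 4 + Ideal.absNorm v.asIdeal) •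
                doubleCosetOp k (recordHyperspecial K v l H) (g 0)) :=
  (exists_sq_eq_and_complexConj_ne K).elim fun _ h => h.elim fun _ h =>
    (exists_cells_three_term_record_of_staysPrime K v w h.1 h.2 hmap l k hl hH hdet hgood).elim fun _ h1 =>
      h1.elim fun _ h2 => h2.elim fun g h3 => ⟨g, h3.2.2.2⟩

end Record

end Summit.Ventures.HodgeRepro2.T5RecordSatakeRecurrenceIntrinsic
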